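import Summits.Ventures.HSemireg.WedgeHankelRecurrenceGaussLRChristoffel

/-!
# Venture HSemireg — **THE `ℓ¹` (LIDSKII–WIELANDT) BOUND FOR DIAGONAL PERTURBATIONS**: if two positive recurrences share the couplings `b` and have diagonals `a`, `a'`, the increasing zeros
# `x`, `y` of their `q_{t+1}`, `q'_{t+1}` satisfy **`Σ_k |y_k − x_k| ≤ Σ_{i ≤ t} |a'_i − a_i|`** — by monotonicity (N323) both `x` and `y` lie below the zeros `z` of the recurrence with diagonal
# `max(a_i, a'_i)`, and the three traces are `Σ a`, `Σ a'`, `Σ max(a, a')` (N298); complements Weyl's `ℓ^∞` bound `|y_k − x_k| ≤ max_i |a'_i − a_i|` (N324) and the trace balance (N353)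

HONEST FRAMING. Part of the Lean index of the computation cell `pub-hsemireg` (seat p10 gen 46, Sunday typer «UNIFORM-IN-n»).  Real polynomials and finite sums only; no variety, no cohomology theory,
no sheaf, no Ext group and no semiregularity map is constructed here; nothing here says that HC / HC_CM / HC_AV holds; no Literature fact (unproved `Prop`) is declared or used.  Custodian versions
as in `WedgeHankelSiegelIdeal` (1/3).
SOURCES (cited).  V. B. Lidskii, *On the characteristic numbers of the sum and product of symmetric matrices*, Dokl. Akad. Nauk SSSR 75 (1950) 769–772; H. Wielandt, *An extremum property of sums of
eigenvalues*, Proc. Amer. Math. Soc. 6 (1955) 106–110; R. Bhatia, *Matrix Analysis* (1997), Thm III.4.1 and Ex. III.4.4 (`Σ|λ_j(A) − λ_j(B)| ≤ ‖A − B‖_1`); for Jacobi matrices: B. N. Parlett,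
*The Symmetric Eigenvalue Problem* (1980), §10.
PROOF TYPED HERE.  With `c_i = max(a_i, a'_i)`: N323 `zeros_mono_diagonal` gives `x_k ≤ z_k`, `y_k ≤ z_k`; N298 `sum_recurrence_zeros` gives `Σ x = Σ a`, `Σ y = Σ a'`, `Σ z = Σ c`; and
`|y_k − x_k| ≤ (z_k − x_k) + (z_k − y_k)`, `2 max(a, a') − a − a' = |a' − a|`.
DEDUP DISCLOSURE (`rg -n 'zeros_l1|lidskii|sum_abs_sub' Summits/Ventures/HSemireg`, 2026-09-03): N324 `zeros_perturbation_diagonal` (`ℓ^∞`), N353 `zeros_sum_balance` (signed trace), N354 (`ℓ^∞`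
with couplings); the `ℓ¹` bound is new.  The 2 names below: 0 hits tree-wide.

WHAT IS IN THE TREE.  N323 `zeros_mono_diagonal`; N298 `sum_recurrence_zeros`; N360 `recurrence_of_coefficients`; N279 `recurrence_zeros_interlace`.
THIS FILE (namespace `Summit.Ventures.HSemireg.Wedge.HankelOuter` continued; CHAINED on N386 (import only); 0 definitions):
* §1152 `two_mul_max_sub_sub` (`2 max(p, q) − p − q = |q − p|`), **`zeros_l1_perturbation_diagonal`** (`Σ_k |y_k − x_k| ≤ Σ_{i ≤ t} |a'_i − a_i|`).
CAVEATS.  Diagonal perturbations only (same couplings); the full Lidskii majorisation and the Hoffman–Wielandt `ℓ²` bound are not typed.  Nothing Ext-side.  New names only.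
-/

open Module Polynomial
open scoped Matrix Polynomial

namespace Summit.Ventures.HSemireg.Wedge.HankelOuter

/-! ## §1152. The `ℓ¹` perturbation bound -/

/-- `2 · max(p, q) − p − q = |q − p|`. [bookkeeping; this file, §1152] -/
theorem two_mul_max_sub_sub (p q : ℝ) : 2 * max p q - p - q = |q - p| := by
  rcases le_total p q with h | h
  · rw [max_eq_right h, abs_of_nonneg (sub_nonneg.2 h)]; ring
  · rw [max_eq_left h, abs_of_nonpos (sub_nonpos.2 h)]; ring

/-- **LIDSKII–WIELANDT FOR JACOBI DATA (diagonal perturbations): `Σ_k |y_k − x_k| ≤ Σ_{i ≤ t} |a'_i − a_i|`.** [Lidskii 1950; Wielandt 1955; Bhatia Ex. III.4.4; this file, §1152] -/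
theorem zeros_l1_perturbation_diagonal {q q' : ℕ → ℝ[X]} {a a' b : ℕ → ℝ} (hq0 : q 0 = 1) (hq1 : q 1 = Polynomial.X - C (a 0))
    (hrec : ∀ n, q (n + 2) = (Polynomial.X - C (a (n + 1))) * q (n + 1) - C (b (n + 1)) * q n)
    (hq0' : q' 0 = 1) (hq1' : q' 1 = Polynomial.X - C (a' 0)) (hrec' : ∀ n, q' (n + 2) = (Polynomial.X - C (a' (n + 1))) * q' (n + 1) - C (b (n + 1)) * q' n)
    (hb : ∀ j, 0 < b j) {t : ℕ} {x y : Fin (t + 1) → ℝ} (hx : StrictMono x) (hxq : q (t + 1) = ∏ j, (Polynomial.X - C (x j))) (hy : StrictMono y)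
    (hyq : q' (t + 1) = ∏ j, (Polynomial.X - C (y j))) : ∑ k, |y k - x k| ≤ ∑ i ∈ Finset.range (t + 1), |a' i - a i| := by
  -- the dominating recurrence with diagonal `max(a, a')`
  obtain ⟨Q, hQ0, hQ1, hQrec⟩ := recurrence_of_coefficients (fun i => max (a i) (a' i)) b
  obtain ⟨z, -, hz, -, hzq, -, -⟩ := recurrence_zeros_interlace (q := Q) (a := fun i => max (a i) (a' i)) (b := b) hQ0 hQ1 hQrec hb t
  have hxz : ∀ k, x k ≤ z k := zeros_mono_diagonal (a' := fun i => max (a i) (a' i)) hq0 hq1 hrec hQ0 hQ1 hQrec hb (fun i _ => le_max_left _ _) hx hxq hz hzq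
  have hyz : ∀ k, y k ≤ z k := zeros_mono_diagonal (a' := fun i => max (a i) (a' i)) hq0' hq1' hrec' hQ0 hQ1 hQrec hb (fun i _ => le_max_right _ _) hy hyq hz hzq
  have hsx := sum_recurrence_zeros hq0 hq1 hrec hxq
  have hsy := sum_recurrence_zeros hq0' hq1' hrec' hyq
  have hsz := sum_recurrence_zeros (a := fun i => max (a i) (a' i)) hQ0 hQ1 hQrec hzq
  calc ∑ k, |y k - x k| ≤ ∑ k, ((z k - x k) + (z k - y k)) := Finset.sum_le_sum fun k _ => by
          rw [abs_le]; constructor <;> linarith [hxz k, hyz k]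
    _ = 2 * ∑ k, z k - ∑ k, x k - ∑ k, y k := by rw [Finset.sum_add_distrib, Finset.sum_sub_distrib, Finset.sum_sub_distrib]; ring
    _ = ∑ i ∈ Finset.range (t + 1), (2 * max (a i) (a' i) - a i - a' i) := by
          rw [hsx, hsy, hsz, Finset.sum_sub_distrib, Finset.sum_sub_distrib, Finset.mul_sum]
    _ = ∑ i ∈ Finset.range (t + 1), |a' i - a i| := Finset.sum_congr rfl fun i _ => two_mul_max_sub_sub _ _

end Summit.Ventures.HSemireg.Wedge.HankelOuter
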